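import Summits.KontsevichZagierPeriods.KontsevichZagierPeriods.Theorems.GpcZeta4Eq4zeta31.Negative.Core

/-!
# `GpcZeta4Eq4zeta31` (stmt-KontsevichZagierPeriods-0275): the crux from the two weight-4 instances

Addendum to `Negative/Core.lean` (cdisprove unit, route `Grothendieck`): what a prover has to land to close
the crux by the stuffle/shuffle line — exactly TWO memberships in `KZ.relations` at `s = t = (2)` for the
canonical assignment `Zcan` (`crux_of_instances22`): the stuffle `[Δ₂]·[Δ₂] − ([Δ₂₂] + [Δ₂₂] + [Δ₄])`
(cubical coordinates, one Fubini product, two integrand-additivity moves with POSITIVE summands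
`1/((1−P)(1−a)) = 1/(1−P) + a/((1−a)(1−P))`, `b/((1−P)(1−b))`, and three polynomial changes of variables
cube → simplex — every intermediate absolutely convergent, all in dimension 4, no Newton–Leibniz move) and
the shuffle dissection `[Δ₂]·[Δ₂] − (2[Δ₂₂] + 4[Δ₃₁])` (six simplices of `Δ₂ × Δ₂`, coordinate
permutations, null walls).
-/

noncomputable section

namespace Summit.KontsevichZagierPeriods.GpcZeta4Eq4zeta31.Negative

open Set MeasureTheory
open Literature.NumberTheory.Transcendental
open Literature.NumberTheory.Transcendental.KZ
open Summit.KontsevichZagierPeriods.KontsevichZagierPeriods.Theses.Grothendieck (GpcZeta4Eq4zeta31)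
open Summit.KontsevichZagierPeriods.MzvKernelInKZ.Negative
open Summit.KontsevichZagierPeriods.Theorems.StuffleInKZ.Negative (simplexOf Zcan Zcan_of_isAdmissible)

/-- **The crux from the TWO weight-4 instances alone** (what a prover has to land): the stuffle
membership at `s = t = (2)`, `[Δ₂]·[Δ₂] − ([Δ₂₂] + [Δ₂₂] + [Δ₄]) ∈ relations`, and the shuffle-dissection
membership at `(2),(2)`, `[Δ₂]·[Δ₂] − (2[Δ₂₂] + 4[Δ₃₁]) ∈ relations` (canonical assignment `Zcan`).
[folklore] -/
theorem crux_of_instances22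
    (hst : Zcan [2] * Zcan [2] - (Zcan [2, 2] + Zcan [2, 2] + Zcan [4]) ∈ relations)
    (hsh : Zcan [2] * Zcan [2] - (2 • Zcan [2, 2] + 4 • Zcan [3, 1]) ∈ relations) : GpcZeta4Eq4zeta31 := by
  have h22 : MZV.IsAdmissible [2, 2] := by decide
  have h31 : MZV.IsAdmissible [3, 1] := by decide
  have h4 : MZV.IsAdmissible [4] := by decide
  have c := relations.sub_mem hst hsh
  rw [Zcan_of_isAdmissible _ h22, Zcan_of_isAdmissible _ h31, Zcan_of_isAdmissible _ h4,
    simplexOf_four, simplexOf_three_one] at c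
  have h1 : 4 • of (wordRep ω31 1 adm_ω31) - of (wordRep ω4 1 adm_ω4) ∈ relations := by
    convert c using 1
    abel
  rw [crux_iff_target, cFds4_eq]
  have h2 : of (wordRep ω31 4 adm_ω31) - 4 • of (wordRep ω31 1 adm_ω31) ∈ relations := by
    simpa using of_wordRep_natCast_sub_nsmul_mem ω31 adm_ω31 4
  have e : of (wordRep ω4 1 adm_ω4) - of (wordRep ω31 4 adm_ω31) =
      -(4 • of (wordRep ω31 1 adm_ω31) - of (wordRep ω4 1 adm_ω4)) -
        (of (wordRep ω31 4 adm_ω31) - 4 • of (wordRep ω31 1 adm_ω31)) := by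
    abel
  rw [e]
  exact relations.sub_mem (relations.neg_mem h1) h2

end Summit.KontsevichZagierPeriods.GpcZeta4Eq4zeta31.Negative
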